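import Summits.QuantumAdvantage.AdviceFreeQNC0.KernelFibration
import HarnessLib

/-!
# Cell qa-qnc0 — LOCAL MOVES of the kernel fibration, the transport identity, loss ≥ ½·influence
(planner qa-qnc0-p1 g19, ROUND-18 §2–§3; `exp19/Sketch19.lean` §3–§4, statements VERBATIM)

On top of `KernelFibration.lean` (`kline`, `flipAt`, `IsOdd`, `stake`, move M1 `kline_flipPair`):

* `kline_hop` (M2, particle hop `k → k+1`): on `{J_k = 0, x_k = 1, J_{k+2} = 1}` flipping the bits
  `k-1, k+2` keeps the odd class and gives `J ↦ J ⊕ e_k ⊕ e_{k+1}`;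
* `kline_create` (M3, pair creation at `k`): on `{J_{k-1} = J_k = J_{k+1} = 1}` flipping the bits
  `k-1, k+1` keeps the odd class and gives `J ↦ J ⊕ e_k`;
  (both: the kernel equation of the flipped pattern against the claimed vector holds at the ≤ 4
  touched positions and is unchanged elsewhere; then the uniqueness principle `kline_eq_iff_inKernel`;)
* `rel_iff_stake`, `win_transport` (M4): `WIN(x') ⊕ WIN(x) = ⟨J(x), b(x') ⊕ b(x)⟩ ⊕ ⟨J(x') ⊕ J(x), b(x')⟩`
  for any two odd patterns and any strategy (`𝔽₂`-bilinearity of `dot2`);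
* `card_changed_le_two_mul_card_lose` (§4, loss ≥ ½·influence): for an injective odd-class-preserving
  map `M` on `D`, the number of `x ∈ D` whose win bit changes under `M` is at most twice the number of
  odd losing patterns — the easy half of the planner's (INF) reformulation of `RingHardOdd 3`.

Numerics: planner's `exp19/fib_check.py` (moves verified exactly for n ≤ 13, 0 failures).

WHAT THIS IS NOT: no bound for any strategy class; crux 22907 untouched; separation NOT moved.
-/

namespace Summit.QuantumAdvantage.AdviceFreeQNC0.Fib19

open Finset Literature.Computability.QuantumComplexity Literature.Computability.QuantumComplexity.RingHLF

variable {n : ℕ}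

/-! ### Cyclic distinctness -/

/-- `k + 1 ≠ k` on a cycle of length `≥ 2` (`k + 2 ≠ k` for `n ≥ 3` is `GraphHLF.nxt_nxt_ne`; below we use
`nxt_iterate_ne_self` directly to keep the imports light). -/
theorem nxt_ne_self (hn : 2 ≤ n) (k : Fin n) : nxt k ≠ k :=
  nxt_iterate_ne_self k (j := 1) Nat.one_pos (by omega)

/-- `k + 3 ≠ k` on a cycle of length `≥ 4`. -/
theorem nxt_nxt_nxt_ne_self (hn : 4 ≤ n) (k : Fin n) : nxt (nxt (nxt k)) ≠ k :=
  nxt_iterate_ne_self k (j := 3) (by norm_num) (by omega)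

/-- `prv b = c ↔ b = nxt c`. -/
theorem prv_eq_iff {b c : Fin n} : prv b = c ↔ b = nxt c := by
  constructor
  · rintro rfl; rw [nxt_prv]
  · rintro rfl; rw [prv_nxt]

/-- `nxt b = c ↔ b = prv c`. -/
theorem nxt_eq_iff {b c : Fin n} : nxt b = c ↔ b = prv c := by
  constructor
  · rintro rfl; rw [prv_nxt]
  · rintro rfl; rw [nxt_prv]

/-! ### §3 Local moves M2 (hop) and M3 (creation) -/

/-- **M2 (particle hop `k → k+1`).** On `{J_k = 0, x_k = 1, J_{k+2} = 1}` flipping the bits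
`k-1, k+2` keeps the odd class and moves the particle: `J ↦ J ⊕ e_k ⊕ e_{k+1}`.
(Kernel equation of the new pattern against `J ⊕ e_k ⊕ e_{k+1}` at `k-1, k, k+1, k+2`; unchanged
elsewhere; uniqueness.) -/
theorem kline_hop (hn : 5 ≤ n) (x : Fin n → Bool) (hodd : IsOdd x) (k : Fin n)
    (hk : kline x k = false) (hxk : x k = true) (hk2 : kline x (nxt (nxt k)) = true) :
    IsOdd (flipAt x {prv k, nxt (nxt k)}) ∧
      kline (flipAt x {prv k, nxt (nxt k)}) = flipAt (kline x) {k, nxt k} := by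
  have hn3 : 3 ≤ n := by omega
  set J := kline x with hJ
  have hK : InKernel x J := kline_inKernel hn3 x hodd
  have hc : HardCore J := kline_hardCore hn3 x hodd
  have hJp : J (prv k) = true := hc.prv_eq_true hk
  have hJn : J (nxt k) = true := hc.nxt_eq_true hk
  -- distinctness of the six positions `k-2, …, k+3` as far as needed
  have d1 : nxt k ≠ k := nxt_ne_self (by omega) k
  have d2 : nxt (nxt k) ≠ k := nxt_iterate_ne_self k (j := 2) (by norm_num) (by omega)
  have d3 : nxt (nxt (nxt k)) ≠ k := nxt_nxt_nxt_ne_self (by omega) k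
  have d1' : nxt (nxt k) ≠ nxt k := nxt_ne_self (by omega) (nxt k)
  have d2' : nxt (nxt (nxt k)) ≠ nxt k :=
    nxt_iterate_ne_self (nxt k) (j := 2) (by norm_num) (by omega)
  have e1 : prv k ≠ k := fun h => d1 (prv_eq_iff.1 h).symm
  have e2 : prv k ≠ nxt k := fun h => d2 (prv_eq_iff.1 h).symm
  have e3 : prv k ≠ nxt (nxt k) := fun h => d3 (prv_eq_iff.1 h).symm
  have e4 : prv (prv k) ≠ k := fun h => e2 (prv_eq_iff.1 h)
  have e5 : prv (prv k) ≠ nxt k := fun h => e3 (prv_eq_iff.1 h)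
  have hK' : InKernel (flipAt x {prv k, nxt (nxt k)}) (flipAt J {k, nxt k}) := by
    intro b
    by_cases b1 : b = prv k
    · rw [b1, nxt_prv,
        flipAt_apply_of_not_mem (show prv (prv k) ∉ ({k, nxt k} : Finset (Fin n)) by simp [e4, e5]),
        flipAt_apply_of_mem (show k ∈ ({k, nxt k} : Finset (Fin n)) by simp),
        flipAt_apply_of_mem (show prv k ∈ ({prv k, nxt (nxt k)} : Finset (Fin n)) by simp),
        flipAt_apply_of_not_mem (show prv k ∉ ({k, nxt k} : Finset (Fin n)) by simp [e1, e2]),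
        hk, hJp]
      have eb := hK (prv k)
      rw [nxt_prv, hk, hJp] at eb
      revert eb
      cases J (prv (prv k)) <;> cases x (prv k) <;> decide
    by_cases b2 : b = k
    · rw [b2, flipAt_apply_of_not_mem (show prv k ∉ ({k, nxt k} : Finset (Fin n)) by simp [e1, e2]),
        flipAt_apply_of_mem (show nxt k ∈ ({k, nxt k} : Finset (Fin n)) by simp),
        flipAt_apply_of_not_mem (show k ∉ ({prv k, nxt (nxt k)} : Finset (Fin n)) by
          simp [e1.symm, d2.symm]),
        flipAt_apply_of_mem (show k ∈ ({k, nxt k} : Finset (Fin n)) by simp), hJp, hJn, hxk, hk]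
      decide
    by_cases b3 : b = nxt k
    · rw [b3, prv_nxt, flipAt_apply_of_mem (show k ∈ ({k, nxt k} : Finset (Fin n)) by simp),
        flipAt_apply_of_not_mem (show nxt (nxt k) ∉ ({k, nxt k} : Finset (Fin n)) by simp [d2, d1']),
        flipAt_apply_of_not_mem (show nxt k ∉ ({prv k, nxt (nxt k)} : Finset (Fin n)) by
          simp [e2.symm, d1'.symm]),
        flipAt_apply_of_mem (show nxt k ∈ ({k, nxt k} : Finset (Fin n)) by simp), hk, hk2, hJn]
      cases x (nxt k) <;> decide
    by_cases b4 : b = nxt (nxt k)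
    · rw [b4, prv_nxt, flipAt_apply_of_mem (show nxt k ∈ ({k, nxt k} : Finset (Fin n)) by simp),
        flipAt_apply_of_not_mem (show nxt (nxt (nxt k)) ∉ ({k, nxt k} : Finset (Fin n)) by
          simp [d3, d2']),
        flipAt_apply_of_mem (show nxt (nxt k) ∈ ({prv k, nxt (nxt k)} : Finset (Fin n)) by simp),
        flipAt_apply_of_not_mem (show nxt (nxt k) ∉ ({k, nxt k} : Finset (Fin n)) by simp [d2, d1']),
        hJn, hk2]
      have eb := hK (nxt (nxt k))
      rw [prv_nxt, hJn, hk2] at eb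
      revert eb
      cases J (nxt (nxt (nxt k))) <;> cases x (nxt (nxt k)) <;> decide
    · have hpT : prv b ∉ ({k, nxt k} : Finset (Fin n)) := by simp [prv_eq_iff, b3, b4]
      have hnT : nxt b ∉ ({k, nxt k} : Finset (Fin n)) := by simp [nxt_eq_iff, b1, b2]
      have hbS : b ∉ ({prv k, nxt (nxt k)} : Finset (Fin n)) := by simp [b1, b4]
      have hbT : b ∉ ({k, nxt k} : Finset (Fin n)) := by simp [b2, b3]
      rw [flipAt_apply_of_not_mem hpT, flipAt_apply_of_not_mem hnT, flipAt_apply_of_not_mem hbS,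
        flipAt_apply_of_not_mem hbT]
      exact hK b
  have hodd' : IsOdd (flipAt x {prv k, nxt (nxt k)}) :=
    (isOdd_flipAt_of_even x _ (by rw [card_pair e3])).2 hodd
  refine ⟨hodd', (kline_eq_iff_inKernel hn3 _ hodd' (ne_zero_of_apply_eq_true (i := k) ?_)).2 hK'⟩
  rw [flipAt_apply_of_mem (show k ∈ ({k, nxt k} : Finset (Fin n)) by simp), hk]
  rfl

/-- **M3 (pair creation at `k`).** On `{J_{k-1} = J_k = J_{k+1} = 1}` flipping the bits `k-1, k+1`
keeps the odd class and creates a particle at `k`: `J ↦ J ⊕ e_k`.  (Kernel equation of the new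
pattern against `J ⊕ e_k` at `k-1, k, k+1`; unchanged elsewhere; uniqueness.) -/
theorem kline_create (hn : 4 ≤ n) (x : Fin n → Bool) (hodd : IsOdd x) (k : Fin n)
    (h1 : kline x (prv k) = true) (h2 : kline x k = true) (h3 : kline x (nxt k) = true) :
    IsOdd (flipAt x {prv k, nxt k}) ∧ kline (flipAt x {prv k, nxt k}) = flipAt (kline x) {k} := by
  have hn3 : 3 ≤ n := by omega
  set J := kline x with hJ
  have hK : InKernel x J := kline_inKernel hn3 x hodd
  have d1 : nxt k ≠ k := nxt_ne_self (by omega) k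
  have d2 : nxt (nxt k) ≠ k := nxt_iterate_ne_self k (j := 2) (by norm_num) (by omega)
  have e1 : prv k ≠ k := fun h => d1 (prv_eq_iff.1 h).symm
  have e2 : prv k ≠ nxt k := fun h => d2 (prv_eq_iff.1 h).symm
  have e3 : prv (prv k) ≠ k := fun h => e2 (prv_eq_iff.1 h)
  have hK' : InKernel (flipAt x {prv k, nxt k}) (flipAt J {k}) := by
    intro b
    by_cases b1 : b = prv k
    · rw [b1, nxt_prv, flipAt_apply_of_not_mem (show prv (prv k) ∉ ({k} : Finset (Fin n)) by simp [e3]),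
        flipAt_apply_of_mem (show k ∈ ({k} : Finset (Fin n)) by simp),
        flipAt_apply_of_mem (show prv k ∈ ({prv k, nxt k} : Finset (Fin n)) by simp),
        flipAt_apply_of_not_mem (show prv k ∉ ({k} : Finset (Fin n)) by simp [e1]), h2, h1]
      have eb := hK (prv k)
      rw [nxt_prv, h2, h1] at eb
      revert eb
      cases J (prv (prv k)) <;> cases x (prv k) <;> decide
    by_cases b2 : b = k
    · rw [b2, flipAt_apply_of_not_mem (show prv k ∉ ({k} : Finset (Fin n)) by simp [e1]),
        flipAt_apply_of_not_mem (show nxt k ∉ ({k} : Finset (Fin n)) by simp [d1]),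
        flipAt_apply_of_mem (show k ∈ ({k} : Finset (Fin n)) by simp), h1, h2, h3]
      cases flipAt x {prv k, nxt k} k <;> decide
    by_cases b3 : b = nxt k
    · rw [b3, prv_nxt, flipAt_apply_of_mem (show k ∈ ({k} : Finset (Fin n)) by simp),
        flipAt_apply_of_not_mem (show nxt (nxt k) ∉ ({k} : Finset (Fin n)) by simp [d2]),
        flipAt_apply_of_mem (show nxt k ∈ ({prv k, nxt k} : Finset (Fin n)) by simp),
        flipAt_apply_of_not_mem (show nxt k ∉ ({k} : Finset (Fin n)) by simp [d1]), h2, h3]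
      have eb := hK (nxt k)
      rw [prv_nxt, h2, h3] at eb
      revert eb
      cases J (nxt (nxt k)) <;> cases x (nxt k) <;> decide
    · have hpT : prv b ∉ ({k} : Finset (Fin n)) := by simp [prv_eq_iff, b3]
      have hnT : nxt b ∉ ({k} : Finset (Fin n)) := by simp [nxt_eq_iff, b1]
      have hbS : b ∉ ({prv k, nxt k} : Finset (Fin n)) := by simp [b1, b3]
      have hbT : b ∉ ({k} : Finset (Fin n)) := by simp [b2]
      rw [flipAt_apply_of_not_mem hpT, flipAt_apply_of_not_mem hnT, flipAt_apply_of_not_mem hbS,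
        flipAt_apply_of_not_mem hbT]
      exact hK b
  have hodd' : IsOdd (flipAt x {prv k, nxt k}) :=
    (isOdd_flipAt_of_even x _ (by rw [card_pair (prv_ne_nxt hn3 k)])).2 hodd
  refine ⟨hodd', (kline_eq_iff_inKernel hn3 _ hodd' (ne_zero_of_apply_eq_true (i := prv k) ?_)).2 hK'⟩
  rw [flipAt_apply_of_not_mem (show prv k ∉ ({k} : Finset (Fin n)) by simp [e1]), h1]

/-! ### The transport identity (M4) -/

/-- The win bit in stake form (`RingFlipMap.rel_iff_odd_stake`, restated with `kline`/`stake`). -/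
theorem rel_iff_stake (hn : 3 ≤ n) (z : (Fin n → Bool) → (Fin n → Bool)) (x : Fin n → Bool)
    (hodd : IsOdd x) : Rel x (z x) ↔ dot2 (kline x) (stake z x) = 1 :=
  rel_iff_odd_stake hn x hodd (z x)

/-- `dot2` is additive in the second argument modulo `2`. -/
theorem dot2_xor_right (v z w : Fin n → Bool) :
    dot2 v (fun k => xor (z k) (w k)) = (dot2 v z + dot2 v w) % 2 := by
  unfold dot2
  rw [card_filter, card_filter, card_filter, Nat.add_mod, Nat.mod_mod, Nat.mod_mod, ← Nat.add_mod,
    ← sum_add_distrib, Finset.sum_nat_mod, Finset.sum_congr rfl fun b _ => ?_, ← Finset.sum_nat_mod]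
  have key : ∀ (vb zb wb : Bool), (if (vb = true ∧ (xor zb wb) = true) then 1 else 0 : ℕ) % 2 =
      ((if (vb = true ∧ zb = true) then 1 else 0) + (if (vb = true ∧ wb = true) then 1 else 0)) % 2 := by
    decide
  exact key (v b) (z b) (w b)

/-- `dot2` is additive in the first argument modulo `2`. -/
theorem dot2_xor_left (v v' z : Fin n → Bool) :
    dot2 (fun k => xor (v k) (v' k)) z = (dot2 v z + dot2 v' z) % 2 := by
  unfold dot2
  rw [card_filter, card_filter, card_filter, Nat.add_mod, Nat.mod_mod, Nat.mod_mod, ← Nat.add_mod,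
    ← sum_add_distrib, Finset.sum_nat_mod, Finset.sum_congr rfl fun b _ => ?_, ← Finset.sum_nat_mod]
  have key : ∀ (vb vb' zb : Bool), (if ((xor vb vb') = true ∧ zb = true) then 1 else 0 : ℕ) % 2 =
      ((if (vb = true ∧ zb = true) then 1 else 0) + (if (vb' = true ∧ zb = true) then 1 else 0)) % 2 := by
    decide
  exact key (v b) (v' b) (z b)

/-- **M4 (universal transport identity** — pure `𝔽₂`-bilinearity of `dot2`). For two odd patterns
`x, x'` and any strategy `z`:
`WIN(x') ⊕ WIN(x) = ⟨J(x), b(x') ⊕ b(x)⟩ ⊕ ⟨J(x') ⊕ J(x), b(x')⟩` (`b` = stake). With M1–M3 the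
second term is `0` (coin-pair flip), `b_k(x') ⊕ b_{k+1}(x')` (hop), `b_k(x')` (creation). -/
theorem win_transport (hn : 3 ≤ n) (z : (Fin n → Bool) → (Fin n → Bool)) (x x' : Fin n → Bool)
    (hodd : IsOdd x) (hodd' : IsOdd x') :
    (Rel x' (z x') ↔ Rel x (z x)) ↔
      (dot2 (kline x) (fun i => xor (stake z x' i) (stake z x i)) +
        dot2 (fun i => xor (kline x' i) (kline x i)) (stake z x')) % 2 = 0 := by
  rw [rel_iff_stake hn z x hodd, rel_iff_stake hn z x' hodd']
  have h1 : dot2 (kline x') (stake z x') =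
      (dot2 (kline x) (stake z x') + dot2 (fun i => xor (kline x' i) (kline x i)) (stake z x')) % 2 := by
    rw [← dot2_xor_left]
    congr 1
    funext i
    cases kline x i <;> cases kline x' i <;> rfl
  have h2 : dot2 (kline x) (stake z x') =
      (dot2 (kline x) (stake z x) + dot2 (kline x) (fun i => xor (stake z x' i) (stake z x i))) % 2 := by
    rw [← dot2_xor_right]
    congr 1
    funext i
    cases stake z x i <;> cases stake z x' i <;> rfl
  have l1 : dot2 (kline x) (stake z x) < 2 := Nat.mod_lt _ two_pos
  have l2 : dot2 (kline x) (fun i => xor (stake z x' i) (stake z x i)) < 2 := Nat.mod_lt _ two_pos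
  have l3 : dot2 (fun i => xor (kline x' i) (kline x i)) (stake z x') < 2 := Nat.mod_lt _ two_pos
  rw [h1, h2]
  omega

/-! ### §4 Engine: loss ≥ ½ · influence (the easy half of (INF), ROUND-18 §3) -/

/-- **loss ≥ ½·influence.** If `M` is injective on `D`, maps `D` into the odd class, and `D` lies in
the odd class, then the number of `x ∈ D` whose win bit CHANGES under `M` is at most twice the
number of odd losing patterns (each change exhibits a loss at `x` or at `M x`).  Consequence: a
strategy losing on `≤ δ·2^{n-1}` odd patterns has EVERY move influence `≤ 2δ·2^{n-1}`; so an
influence lower bound `η·2^{n-1}` for ONE move of each polylog-degree strategy gives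
`RingHardOdd 3` with `θ = 1 - η/2`. -/
theorem card_changed_le_two_mul_card_lose (z : (Fin n → Bool) → (Fin n → Bool))
    (M : (Fin n → Bool) → (Fin n → Bool)) (D : Finset (Fin n → Bool))
    (hD : ∀ x ∈ D, IsOdd x ∧ IsOdd (M x)) (hinj : Set.InjOn M ↑D) :
    (D.filter fun x => ¬ (Rel x (z x) ↔ Rel (M x) (z (M x)))).card ≤
      2 * (univ.filter fun x : Fin n → Bool => IsOdd x ∧ ¬ Rel x (z x)).card := by
  have hsub : (D.filter fun x => ¬ (Rel x (z x) ↔ Rel (M x) (z (M x)))) ⊆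
      (D.filter fun x => ¬ Rel x (z x)) ∪ (D.filter fun x => ¬ Rel (M x) (z (M x))) := by
    intro x hx
    rw [mem_filter] at hx
    rw [mem_union, mem_filter, mem_filter]
    by_cases h : Rel x (z x)
    · exact Or.inr ⟨hx.1, fun h' => hx.2 ⟨fun _ => h', fun _ => h⟩⟩
    · exact Or.inl ⟨hx.1, h⟩
  have h1 : (D.filter fun x => ¬ Rel x (z x)).card ≤
      (univ.filter fun x : Fin n → Bool => IsOdd x ∧ ¬ Rel x (z x)).card := by
    refine card_le_card fun x hx => ?_
    rw [mem_filter] at hx ⊢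
    exact ⟨mem_univ _, (hD x hx.1).1, hx.2⟩
  have h2 : (D.filter fun x => ¬ Rel (M x) (z (M x))).card ≤
      (univ.filter fun x : Fin n → Bool => IsOdd x ∧ ¬ Rel x (z x)).card := by
    rw [← card_image_of_injOn (s := D.filter fun x => ¬ Rel (M x) (z (M x))) (f := M)
      (hinj.mono (coe_subset.2 (filter_subset _ _)))]
    refine card_le_card fun y hy => ?_
    rw [mem_image] at hy
    obtain ⟨x, hx, rfl⟩ := hy
    rw [mem_filter] at hx ⊢
    exact ⟨mem_univ _, (hD x hx.1).2, hx.2⟩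
  calc (D.filter fun x => ¬ (Rel x (z x) ↔ Rel (M x) (z (M x)))).card
      ≤ ((D.filter fun x => ¬ Rel x (z x)) ∪ (D.filter fun x => ¬ Rel (M x) (z (M x)))).card :=
        card_le_card hsub
    _ ≤ (D.filter fun x => ¬ Rel x (z x)).card + (D.filter fun x => ¬ Rel (M x) (z (M x))).card :=
        card_union_le _ _
    _ ≤ _ := by omega

end Summit.QuantumAdvantage.AdviceFreeQNC0.Fib19
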